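import Literature.MathematicalPhysics.QuantumFieldTheory.BalabanImbrieJaffe1984to88.BIJ88Eq532Torus

/-!
# `BalabanImbrieJaffe1984to88.BIJ88Eq533Torus` — T. Bałaban, J. Imbrie, A. Jaffe, *Effective action and cluster properties of the abelian
Higgs model*, Commun. Math. Phys. **114** (1988) 257–315 [BalabanImbrieJaffe1988], **(5.3.3)** p. 280: the background gauge field `u_k`
of (4.2) AFTER the first gauge-field translation (5.3.1) — ON THE TORUS CARRIER OF RECORD (kind «model instance»), with the reduction
*"In Λ̄₂^{(k)*} this simplifies to (5.3.4)"*.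

statement-level skeleton of published theorems with citation tags; proofs where landed; nothing here is a claim about the Yang–Mills mass gap

PDF held: `paper:balaban1988-cmp114-bij-abelian-higgs-effective-action` (journal page = PDF page + 256), p. 280 [PDF 24] read as a
full-resolution image (CCITT-G4 render ×1, crop of (5.3.3) kept in the seat folder `renders/crop533.png`; the ×2 render
`HOME/lit-balaban-r16/renders/cmp114/original-p024-x2.png`); p. 274 [PDF 18] ((4.2)) as quoted verbatim in r18's
`BIJ88Sect4Statements.backgroundU`; [BalabanImbrieJaffe1985] p. 312 [PDF 14] ((4.5.2)–(4.5.3)) read earlier by this seat (gen 3).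

CITATION HEADER (lean-in-tree rule).  Part of the lit-balaban TYPED SKELETON (HOME `run/shared/lean/pub/lit-balaban/`), PHASE-2 proof
seat p31 gen 6 (unit `lit-balaban-p31-g6`; TAKING line HOME/STATUS.md 2026-08-21T09:43Z).  WHAT IS REPRODUCED: row `C2.Eq5.3.1-5.3.7` of
`HOME/lit-balaban-r16/ROWS-C2-part2.md` (owner r16), member **(5.3.3)** (absent before this file) and the sentence leading to (5.3.4)
(r16's `BIJ88Sect5StatementsPart3.bg534`).

THE PRINTED TEXT (verbatim, p. 280 [PDF 24]).  *"As in (3.24) we put u = u′(Λ₁^{(k)*}Q^{s*}v), (5.3.1) … we obtain that u′_b = e^{ie_kA′_b}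
with |A′_b| ≦ cp(e_k), for b ∈ Λ₁^{(k)*}. … Under the translation we have f^{(k)}(p) = Λ₁^{(k)**c}(ie_k)^{−1} log u′(p)v(p′₀) + Λ₁^{(k)**}(∂A′
+ L^{−2}Q^{e*}f)(p), (5.3.2) … After this translation the background gauge field is
u_k = (Λ̄₁^{(k)*c}Q^{s*}_{k+1}v) exp ie_kη[Q^{s*}_kΛ₁^{(k)*}A′ − 𝒟_{k,loc}∂*Q^{e*}_k(Λ₁^{(k)**}(ie_k)^{−1} log u′(p)v(p′₀) + Λ₁^{(k)**}(∂A′ +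
L^{−2}Q^{e*}f))], (5.3.3) for b ∈ Λ̄₆^{(k−1)*}. The background field f_k appearing at some vertices in 𝒫_{k,loc} and in F_{k,loc} is
transformed accordingly. In Λ̄₂^{(k)*} this simplifies to u_k = (Q^{s*}_{k+1}) exp ie_kη[Q^{s*}_kA′ − 𝒟_{k,loc}∂*Q^{e*}_k(∂A′ + L^{−2}Q^{e*}f)],
(5.3.4) cf. (I.6.2.3)."*  And (4.2) p. 274 [PDF 18]: *"in Λ̄₆^{(k−1)*} it simplifies to u_k = (Q^{s*}_ku) exp(−ie_kη𝒟_{k,loc}∂*Q^{e*}_kf^{(k)}),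
(4.2) where f^{(k)}(p) = (ie_k)⁻¹ log u(p)"* (r18's `BIJ88Sect4Statements.backgroundU`; `Λ̄` = *"the union of L^j-blocks at the points
of Λ"*, p. 274).

WHAT (5.3.3) IS.  It is (4.2) with (5.3.1) and (5.3.2) substituted: the argument of `𝒟_{k,loc}∂*Q^{e*}_k` becomes the translated plaquette
field (5.3.2) (this seat's `BIJ88Eq532Torus.eq532_*`, pointwise on the torus; it enters here only through the real η-lattice bond
function `g = 𝒟_{k,loc}∂*Q^{e*}_kf^{(k)}`, data exactly as in the typed (4.2)), and the group-valued prefactor `Q^{s*}_ku` is computed by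
the ALGEBRA OF THE GROUP-VALUED PULL-BACKS [BalabanImbrieJaffe1985] (4.5.3) (this seat's gen-3 `BIJ85Eq453GaugeField.qsstarG/qsstarGIter`,
any value group): multiplicativity `Q^{s*}_k(u′w) = Q^{s*}_ku′·Q^{s*}_kw`, composition `Q^{s*}_kQ^{s*} = Q^{s*}_{k+1}`, and the lifting of a
cut-off through the pull-back `Q^{s*}_k(Λ·w) = Λ̄·Q^{s*}_kw` (`Λ̄` = the bonds whose k-fold block bond lies in `Λ`); for `u′ = e^{ie_kA′}` on
`Λ₁^{(k)*}` the U(1) dictionary (4.5.2) with `ηL^k = 1` turns `Q^{s*}_k(Λ₁*u′)` into `exp(ie_kηQ^{s*}_kΛ₁*A′)`.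

CARRIERS (all of record).  η-lattice = torus level `i`, unit lattice `T₁^{(k)}` = level `i + k`, block lattice = level `i + k + 1` (standing range
`i + k + 1 ≤ m + K`); `U(1) = BIJ88Sect3Statements.U1` read in `ℂ` by `toC`; the small-field region is given by its BLOCK sites
`X = Λ₁^{(k)′} ⊂ T^{(k+1)}` (p. 274: regions are unions of blocks): `Λ₁^{(k)} = blockUnion 1 X` (unit-lattice sites), `Λ₁^{(k)*} = starB (blockUnion 1 X)`
(`BIJ88Sect3Statements.starB`, p. 266 *"X* = bonds with both endpoints in X"*), `Λ̄₁^{(k)} = blockUnion (k+1) X` (η-lattice sites),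
`Λ̄₁^{(k)*} = starB (blockUnion (k+1) X)`; the translation (5.3.1) = `surfMul u′ (cutoff (starB X) v)` (r18's substitution with the coarse cut-off
`Λ₁^{(k)′*} = starB X` of `BIJ88Eq536Linearization.cutoff`; it IS r16's `transl531 Λ₁^{(k)*}` — `transl_eq_transl531` below); `Q^{s*}_k` on
group-valued fields = `qsstarGIter k`, on real bond functions = `(BIJ85Eq224Proof.torusBlockBondsIter P i k).Qsstar` ((2.17) at block size
`L^k`, factor `L^k`); `u′ = e^{ie_kA′}` on `Λ₁*` = r18's `expU1 (e_kA′_b)` (`BIJ88Eq536Linearization.phaseField`).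

WHAT IS PROVED (0 `sorry`, standard axioms, no `Prop`-valued fact introduced; definitions with bodies: `cutoffG` — the cut-off of a
group-valued field to a bond set at ANY level (r18/gen-5's `cutoff` is the level-`j+1`, U(1) case: `cutoff_eq_cutoffG`), `blockUnion k X` — `Λ̄`,
the union of the k-blocks over `X`, `liftBonds k Λ` — the bonds whose k-fold block bond lies in `Λ`).
* §2 pull-back algebra (any `MulOneClass`): `qsstarG_mul`, `qsstarGIter_mul`, **`qsstarGIter_cutoffG`** (`Q^{s*}_k(Λ·V) = liftBonds k Λ · Q^{s*}_kV`),
  `liftBonds_starB_iff`/`cutoffG_liftBonds_starB` (on the bonds that matter `liftBonds k X* = (blockUnion k X)*`, the printed `Λ̄*`),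
  **`qsstarGIter_surfMul`** (`Q^{s*}_k(u′·Q^{s*}w) = Q^{s*}_ku′ · Q^{s*}_{k+1}w`), **`qsstarGIter_transl`**.
* §3 the U(1) dictionary with a cut-off: **`toC_qsstarGIter_cutoffG_phase`** (`Q^{s*}_k(Λ₁*·e^{ie_kA′}) = exp(ie_kη Q^{s*}_k(Λ₁*A′))`, `ηL^k = 1`).
* §4 **(5.3.3) ON THE TORUS**: `eq533_operator` (prefactor `Q^{s*}_k(Λ₁^{*c}u′)·Q^{s*}_{k+1}(Λ₁′*v)`), **`eq533_torus`** (the printed `Λ̄` form: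
  `u_k = (Λ̄₁^{*c}Q^{s*}_ku′)(Λ̄₁^{*}Q^{s*}_{k+1}v) · exp ie_kη[Q^{s*}_kΛ₁*A′ − g]` at EVERY η-bond, for every `v`, every `g`, every `u′` with
  `u′ = e^{ie_kA′}` on `Λ₁*`), **`eq533_inside`** (on `Λ̄₁^{*}`: `u_k = (Q^{s*}_{k+1}v) exp ie_kη[Q^{s*}_kA′ − g]`) and the bridge **`eq534_of_eq533`**
  to r16's `bg534` under the displayed locality of `𝒟_{k,loc}∂*Q^{e*}_k` (`g = T(∂A′ + L^{−2}Q^{e*}f)` on the bond considered) — the sentence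
  *"In Λ̄₂^{(k)*} this simplifies to (5.3.4)"* (Λ̄₂ ⊂ Λ̄₁).
* §5 READING OF THE PRINTED PREFACTOR (recorded in HOME/GAPS.md, owner r16 to rule): the kernel-checked substitution gives the prefactor
  `(Λ̄₁^{(k)*c}Q^{s*}_ku′)(Λ̄₁^{(k)*}Q^{s*}_{k+1}v)` — OUTSIDE `Λ̄₁*` the untranslated `Q^{s*}_ku`, INSIDE the new block field pulled back twice —
  where print has `(Λ̄₁^{(k)*c}Q^{s*}_{k+1}v)` (read here as a haplography; the k = 0 display p. 270 *"u₁ = (Λ₁*Q^{s*}v)(Λ₆^{*c}u⁰)exp(…)"* and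
  (5.3.4)'s prefactor `Q^{s*}_{k+1}v` INSIDE `Λ̄₂* ⊂ Λ̄₁*` both carry the two-factor structure).  Kernel witnesses: `prefactor533_literal_inside`
  (the literal prefactor is `1` on all of `Λ̄₁*`, where (5.3.4) prints `Q^{s*}_{k+1}v`) and **`eq533_literal_ne`** (with no small-field region,
  `Λ₁ = ∅`, the literal right side is not the background field (4.2)).  Likewise the first inner cut-off of (5.3.3) is printed `Λ₁^{(k)**}`
  where (5.3.2) has `Λ₁^{(k)**c}` (the argument is `f^{(k)}` of (5.3.2); not re-spelled here).
Imports: this seat's `BIJ88Eq532Torus` (→ `BIJ88Eq536Linearization`, `BIJ85Eq453GaugeField`, r16's `BIJ88Sect5StatementsPart3`, r18's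
`BIJ88Sect4Statements`); standard axioms.  NOTHING beyond the kernel-checked statements is asserted.  Unit `lit-balaban-p31`
(literature-prover-lit-balaban-p31-g6-0), 2026-08-21.
-/

namespace Literature.MathematicalPhysics.QuantumFieldTheory.BalabanImbrieJaffe1984to88.BIJ88Eq533Torus

open Literature.MathematicalPhysics.QuantumFieldTheory.Balaban1983to89
open BIJ88Sect3Statements (U1 toC toC_mul toC_one starB mem_starB)
open BIJ88Sect4Statements (backgroundU)
open BIJ88Sect5StatementsPart3 (bgExp bracket534 bg534 transl531)
open BIJ85BlockAveragesTorus (expU1 toC_expU1 IsCross coarse surfFactor surfMul blockOf_tgt_of_isCross)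
open BIJ85Eq453GaugeField (qsstarG qsstarG_apply qsstarGIter qsstarGIter_zero qsstarGIter_succ qsstarGIter_eq qsstarGIter_of_interior
  qsstarGIter_of_mem)
open BIJ85Eq224Proof (torusBlockBondsIter mem_BsIter_iff blockOfIter_shift card_BsIter iter_L)
open BIJ88Eq536Linearization (cutoff)
open BIJ88Eq532Torus (surfMul_apply_qsstarG)
open B7SectAStatements (blockOfIter blockOfIter_zero blockOfIter_succ)
open scoped BigOperators Real
open Complex Finset

noncomputable section

variable {P : Params} {i j : ℕ} {G : Type*}

/-! ## §0 Torus bookkeeping -/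

/-- kernel: `y + e_μ ≠ y` on every torus of the series. [folklore] -/
private theorem shift_ne_self {n : ℕ} (y : Balaban1983to89.Site P n) (μ : Fin P.d) : y.shift μ ≠ y := by
  intro h
  have h1 := congrFun h μ
  simp only [Balaban1983to89.Site.shift, Function.update_self] at h1
  exact one_ne_zero (add_eq_left.1 h1)

/-- kernel: a bond strictly inside a k-block lies in no k-corridor `B^s_k(c)`. [cite: BalabanImbrieJaffe1985, (4.5.3) p.312] -/
private theorem not_mem_BsIter_of_interior {k : ℕ} {b : PBond P i} (hb : blockOfIter k b.tgt = blockOfIter k b.src)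
    (c : PBond P (i + k)) : b ∉ (torusBlockBondsIter P i k).Bs c := by
  rw [mem_BsIter_iff]
  rintro ⟨h1, h2⟩
  exact shift_ne_self c.src c.dir (h2.symm.trans (hb.trans h1))

/-- kernel: the k-fold block bond `⟨blockOfIter k b₋, μ⟩` of a bond not strictly inside a k-block, and the far endpoint (standing range).
[cite: BalabanImbrieJaffe1985, (4.5.3) p.312] -/
private theorem blockOfIter_tgt_of_not_interior {k : ℕ} (hk : i + k ≤ P.m + P.K) {b : PBond P i}
    (hb : blockOfIter k b.tgt ≠ blockOfIter k b.src) : blockOfIter k b.tgt = (blockOfIter k b.src).shift b.dir :=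
  (blockOfIter_shift k hk b.src b.dir).resolve_left hb

/-- kernel: a bond not strictly inside a k-block lies in the k-corridor of its k-fold block bond (standing range).
[cite: BalabanImbrieJaffe1985, (4.5.3) p.312] -/
private theorem mem_BsIter_of_not_interior {k : ℕ} (hk : i + k ≤ P.m + P.K) {b : PBond P i}
    (hb : blockOfIter k b.tgt ≠ blockOfIter k b.src) :
    b ∈ (torusBlockBondsIter P i k).Bs (⟨blockOfIter k b.src, b.dir⟩ : PBond P (i + k)) := by
  rw [mem_BsIter_iff]
  exact ⟨rfl, blockOfIter_tgt_of_not_interior hk hb⟩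

/-! ## §1 Cut-offs of group-valued fields, the block unions `Λ̄`, and the lifted bond sets -/

/-- The cut-off of a group-valued bond field to a bond set `Λ`: the field on `Λ`, `1` elsewhere — at any level and for any value type
with a unit (the notation `Λ·w` of (3.24)/(5.3.1)/(5.3.3): *"u_b = u′_bu_{b′} if b ∈ B^s(b′) ∩ Λ₁^{(0)*}, u′_b otherwise"*, p. 269).
[cite: BalabanImbrieJaffe1988, (5.3.1) p.280] -/
def cutoffG [One G] (Λ : Finset (PBond P j)) (V : GaugeField P j G) : GaugeField P j G :=
  fun b => if b ∈ Λ then V b else 1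

/-- kernel: the cut-off field on `Λ`. [cite: BalabanImbrieJaffe1988, (5.3.1) p.280] -/
theorem cutoffG_of_mem [One G] {Λ : Finset (PBond P j)} (V : GaugeField P j G) {b : PBond P j} (hb : b ∈ Λ) :
    cutoffG Λ V b = V b := by
  simp [cutoffG, hb]

/-- kernel: the cut-off field off `Λ`. [cite: BalabanImbrieJaffe1988, (5.3.1) p.280] -/
theorem cutoffG_of_not_mem [One G] {Λ : Finset (PBond P j)} (V : GaugeField P j G) {b : PBond P j} (hb : b ∉ Λ) :
    cutoffG Λ V b = 1 := by
  simp [cutoffG, hb]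

/-- kernel: gen 5's U(1) block-lattice cut-off `BIJ88Eq536Linearization.cutoff` IS `cutoffG` (one object). [cite: BalabanImbrieJaffe1988, (5.3.1) p.280] -/
theorem cutoff_eq_cutoffG (Λ : Finset (PBond P (j + 1))) (v : GaugeField P (j + 1) U1) : cutoff Λ v = cutoffG Λ v := by
  funext c
  by_cases hc : c ∈ Λ
  · rw [BIJ88Eq536Linearization.cutoff_of_mem v hc, cutoffG_of_mem v hc]
  · rw [BIJ88Eq536Linearization.cutoff_of_not_mem v hc, cutoffG_of_not_mem v hc]

/-- kernel: a field is the product of its two complementary cut-offs, `V = (Λᶜ·V)(Λ·V)`. [cite: BalabanImbrieJaffe1988, (5.3.1) p.280] -/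
theorem cutoffG_compl_mul_cutoffG [MulOneClass G] (Λ : Finset (PBond P j)) (V : GaugeField P j G) (b : PBond P j) :
    cutoffG Λᶜ V b * cutoffG Λ V b = V b := by
  by_cases hb : b ∈ Λ
  · rw [cutoffG_of_mem V hb, cutoffG_of_not_mem V (fun h => (Finset.mem_compl.1 h) hb), one_mul]
  · rw [cutoffG_of_not_mem V hb, cutoffG_of_mem V (Finset.mem_compl.2 hb), mul_one]

/-- `Λ̄` of p. 274, verbatim: *"the union of L^j-blocks at the points of Λ"* — here the union of the k-fold blocks `B^k(y)`, `y ∈ X`, i.e. the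
sites `x` of the finer torus with `blockOfIter k x ∈ X`. [cite: BalabanImbrieJaffe1988, (4.1) p.274] -/
def blockUnion (k : ℕ) (X : Finset (Balaban1983to89.Site P (i + k))) : Finset (Balaban1983to89.Site P i) :=
  Finset.univ.filter fun x => blockOfIter k x ∈ X

/-- kernel: membership in `Λ̄`. [cite: BalabanImbrieJaffe1988, (4.1) p.274] -/
theorem mem_blockUnion {k : ℕ} {X : Finset (Balaban1983to89.Site P (i + k))} {x : Balaban1983to89.Site P i} :
    x ∈ blockUnion k X ↔ blockOfIter k x ∈ X := by
  simp [blockUnion]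

/-- kernel: membership in the one-step `Λ̄`: `x ∈ Λ̄ ↔ blockOf x ∈ X` (`x` lies in the block of a site of `X`). [cite: BalabanImbrieJaffe1988, (4.1) p.274] -/
theorem mem_blockUnion_one {X : Finset (Balaban1983to89.Site P (j + 1))} {x : Balaban1983to89.Site P j} :
    x ∈ blockUnion 1 X ↔ blockOf x ∈ X :=
  mem_blockUnion

/-- kernel: `Λ̄` is transitive in the number of steps — the (k+1)-fold block union of `X` is the k-fold block union of the block union of `X`
(`blockOfIter (k+1) = blockOf ∘ blockOfIter k`). [cite: BalabanImbrieJaffe1988, (4.1) p.274] -/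
theorem blockUnion_succ (k : ℕ) (X : Finset (Balaban1983to89.Site P (i + k + 1))) :
    blockUnion (i := i) (k + 1) X = blockUnion k (blockUnion 1 X) := by
  ext x
  rw [mem_blockUnion, mem_blockUnion, mem_blockUnion_one, blockOfIter_succ]

/-- The bonds of the finer torus whose k-fold block bond `⟨blockOfIter k b₋, μ⟩` (the unit-lattice bond whose corridor `B^s_k` would contain `b`,
[BalabanImbrieJaffe1985] (4.5.3)) lies in the bond set `Λ` — the set through which a cut-off passes under `Q^{s*}_k` (`qsstarGIter_cutoffG`).
[cite: BalabanImbrieJaffe1988, (5.3.3) p.280] -/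
def liftBonds (k : ℕ) (Λ : Finset (PBond P (i + k))) : Finset (PBond P i) :=
  Finset.univ.filter fun b => (⟨blockOfIter k b.src, b.dir⟩ : PBond P (i + k)) ∈ Λ

/-- kernel: membership in the lifted bond set. [cite: BalabanImbrieJaffe1988, (5.3.3) p.280] -/
theorem mem_liftBonds {k : ℕ} {Λ : Finset (PBond P (i + k))} {b : PBond P i} :
    b ∈ liftBonds k Λ ↔ (⟨blockOfIter k b.src, b.dir⟩ : PBond P (i + k)) ∈ Λ := by
  simp [liftBonds]

/-- kernel: lifting commutes with complements. [cite: BalabanImbrieJaffe1988, (5.3.3) p.280] -/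
theorem liftBonds_compl (k : ℕ) (Λ : Finset (PBond P (i + k))) : liftBonds (i := i) k Λᶜ = (liftBonds k Λ)ᶜ := by
  ext b
  simp only [mem_liftBonds, Finset.mem_compl]

/-- kernel: ON THE BONDS NOT STRICTLY INSIDE A k-BLOCK the lift of `X*` is `Λ̄*`: `b ∈ liftBonds k (X*) ↔ b ∈ (blockUnion k X)*` — both say
`blockOfIter k b₋ ∈ X` and `blockOfIter k b₊ = blockOfIter k b₋ + e_μ ∈ X` (standing range). [cite: BalabanImbrieJaffe1988, (5.3.3) p.280] -/
theorem liftBonds_starB_iff {k : ℕ} (hk : i + k ≤ P.m + P.K) (X : Finset (Balaban1983to89.Site P (i + k))) {b : PBond P i}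
    (hb : blockOfIter k b.tgt ≠ blockOfIter k b.src) : b ∈ liftBonds k (starB X) ↔ b ∈ starB (blockUnion k X) := by
  rw [mem_liftBonds, mem_starB, mem_starB, mem_blockUnion, mem_blockUnion, blockOfIter_tgt_of_not_interior hk hb]
  exact Iff.rfl

/-! ## §2 The algebra of the group-valued pull-backs `Q^{s*}`, `Q^{s*}_k` ([BalabanImbrieJaffe1985] (4.5.3)) -/

/-- kernel: **`Q^{s*}` is multiplicative**, `Q^{s*}(VW) = Q^{s*}V·Q^{s*}W` — (4.5.3) copies values (`1·1 = 1` inside blocks); any `MulOneClass`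
(the product field `VW` given pointwise). [cite: BalabanImbrieJaffe1985, (4.5.3) p.312] -/
theorem qsstarG_mul [MulOneClass G] (V W VW : GaugeField P (j + 1) G) (h : ∀ c, VW c = V c * W c) (b : PBond P j) :
    qsstarG VW b = qsstarG V b * qsstarG W b := by
  simp only [qsstarG_apply, h]
  split_ifs <;> simp

/-- kernel: **`Q^{s*}_k` is multiplicative** (the product field given pointwise). [cite: BalabanImbrieJaffe1985, (4.5.3) p.312] -/
theorem qsstarGIter_mul [MulOneClass G] : ∀ (k : ℕ) (V W VW : GaugeField P (i + k) G), (∀ c, VW c = V c * W c) →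
    ∀ b : PBond P i, qsstarGIter k VW b = qsstarGIter k V b * qsstarGIter k W b
  | 0, _, _, _, h, b => h b
  | k + 1, V, W, VW, h, b => by
    rw [qsstarGIter_succ, qsstarGIter_succ, qsstarGIter_succ]
    exact qsstarGIter_mul k (qsstarG V) (qsstarG W) (qsstarG VW) (qsstarG_mul V W VW h) b

/-- **A cut-off passes through the pull-back as the lifted cut-off: `Q^{s*}_k(Λ·V) = (liftBonds k Λ)·(Q^{s*}_kV)`** — inside k-blocks both sides are
`1`, on the corridor of the unit-lattice bond `c` both sides are `V(c)` if `c ∈ Λ` and `1` otherwise (standing range).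
[cite: BalabanImbrieJaffe1988, (5.3.3) p.280] -/
theorem qsstarGIter_cutoffG [One G] {k : ℕ} (hk : i + k ≤ P.m + P.K) (Λ : Finset (PBond P (i + k))) (V : GaugeField P (i + k) G)
    (b : PBond P i) : qsstarGIter k (cutoffG Λ V) b = cutoffG (liftBonds k Λ) (qsstarGIter k V) b := by
  by_cases hb : blockOfIter k b.tgt = blockOfIter k b.src
  · rw [qsstarGIter_of_interior hk _ hb.symm]
    by_cases hm : b ∈ liftBonds k Λ
    · rw [cutoffG_of_mem _ hm, qsstarGIter_of_interior hk _ hb.symm]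
    · rw [cutoffG_of_not_mem _ hm]
  · have hmem := mem_BsIter_of_not_interior hk hb
    rw [qsstarGIter_of_mem hk _ hmem]
    by_cases hm : b ∈ liftBonds k Λ
    · rw [cutoffG_of_mem _ hm, qsstarGIter_of_mem hk _ hmem, cutoffG_of_mem _ (mem_liftBonds.1 hm)]
    · rw [cutoffG_of_not_mem _ hm, cutoffG_of_not_mem _ (fun h => hm (mem_liftBonds.2 h))]

/-- kernel: two cut-offs of a pulled-back field agree as soon as the bond sets agree on the bonds not strictly inside a k-block (the pulled-back
field is `1` inside blocks). [cite: BalabanImbrieJaffe1988, (5.3.3) p.280] -/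
theorem cutoffG_qsstarGIter_congr [One G] {k : ℕ} (hk : i + k ≤ P.m + P.K) {S S' : Finset (PBond P i)} (V : GaugeField P (i + k) G)
    (h : ∀ b : PBond P i, blockOfIter k b.tgt ≠ blockOfIter k b.src → (b ∈ S ↔ b ∈ S')) (b : PBond P i) :
    cutoffG S (qsstarGIter k V) b = cutoffG S' (qsstarGIter k V) b := by
  by_cases hb : blockOfIter k b.tgt = blockOfIter k b.src
  · simp only [cutoffG, qsstarGIter_of_interior hk V hb.symm, ite_self]
  · by_cases hm : b ∈ S
    · rw [cutoffG_of_mem _ hm, cutoffG_of_mem _ ((h b hb).1 hm)]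
    · rw [cutoffG_of_not_mem _ hm, cutoffG_of_not_mem _ (fun h' => hm ((h b hb).2 h'))]

/-- **`Q^{s*}_k(X*·V) = Λ̄*·(Q^{s*}_kV)`** with `Λ̄ = blockUnion k X` — the printed way of writing the lifted cut-off (standing range).
[cite: BalabanImbrieJaffe1988, (5.3.3) p.280] -/
theorem qsstarGIter_cutoffG_starB [One G] {k : ℕ} (hk : i + k ≤ P.m + P.K) (X : Finset (Balaban1983to89.Site P (i + k)))
    (V : GaugeField P (i + k) G) (b : PBond P i) :
    qsstarGIter k (cutoffG (starB X) V) b = cutoffG (starB (blockUnion k X)) (qsstarGIter k V) b := by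
  rw [qsstarGIter_cutoffG hk]
  exact cutoffG_qsstarGIter_congr hk V (fun b hb => liftBonds_starB_iff hk X hb) b

/-- … and for the complementary cut-off: `Q^{s*}_k(X^{*c}·V) = Λ̄^{*c}·(Q^{s*}_kV)` (standing range). [cite: BalabanImbrieJaffe1988, (5.3.3) p.280] -/
theorem qsstarGIter_cutoffG_starB_compl [One G] {k : ℕ} (hk : i + k ≤ P.m + P.K) (X : Finset (Balaban1983to89.Site P (i + k)))
    (V : GaugeField P (i + k) G) (b : PBond P i) :
    qsstarGIter k (cutoffG (starB X)ᶜ V) b = cutoffG (starB (blockUnion k X))ᶜ (qsstarGIter k V) b := by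
  rw [qsstarGIter_cutoffG hk, liftBonds_compl]
  refine cutoffG_qsstarGIter_congr hk V (fun b hb => ?_) b
  rw [Finset.mem_compl, Finset.mem_compl, liftBonds_starB_iff hk X hb]

/-- **`Q^{s*}_k(u′·Q^{s*}w) = Q^{s*}_ku′ · Q^{s*}_{k+1}w`** — the translation (3.9)/(5.3.1) (r18's `surfMul u′ w = u′·Q^{s*}w`, the surface factor
being the group-valued pull-back, gen 5's `surfMul_apply_qsstarG`) through the k-fold pull-back: multiplicativity and `Q^{s*}_kQ^{s*} = Q^{s*}_{k+1}`
(standing range). [cite: BalabanImbrieJaffe1988, (5.3.3) p.280] -/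
theorem qsstarGIter_surfMul {k : ℕ} (hk : i + k + 1 ≤ P.m + P.K) (u' : GaugeField P (i + k) U1) (w : GaugeField P (i + k + 1) U1)
    (b : PBond P i) : qsstarGIter k (surfMul u' w) b = qsstarGIter k u' b * qsstarGIter (k + 1) w b := by
  rw [qsstarGIter_mul k u' (qsstarG w) (surfMul u' w) (surfMul_apply_qsstarG hk u' w) b, qsstarGIter_succ]

/-- **The translated field (5.3.1) through the k-fold pull-back**: for `u = u′·(Λ′·Q^{s*}v)` (cut-off `Λ′` on the block-lattice bonds),
`Q^{s*}_ku = Q^{s*}_ku′ · (liftBonds (k+1) Λ′)·Q^{s*}_{k+1}v` (standing range). [cite: BalabanImbrieJaffe1988, (5.3.3) p.280] -/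
theorem qsstarGIter_transl {k : ℕ} (hk : i + k + 1 ≤ P.m + P.K) (u' : GaugeField P (i + k) U1) (Λ' : Finset (PBond P (i + k + 1)))
    (v : GaugeField P (i + k + 1) U1) (b : PBond P i) :
    qsstarGIter k (surfMul u' (cutoff Λ' v)) b = qsstarGIter k u' b * cutoffG (liftBonds (k + 1) Λ') (qsstarGIter (k + 1) v) b := by
  rw [qsstarGIter_surfMul hk, cutoff_eq_cutoffG, qsstarGIter_cutoffG (i := i) (k := k + 1) hk]

/-! ## §3 The U(1) dictionary (4.5.2) with a cut-off -/

/-- **`Q^{s*}_k(Λ₁·u′) = exp(ie_kη Q^{s*}_k(Λ₁·A′))`** read in `ℂ`, for `u′ = e^{ie_kA′}` on the unit-lattice bond set `Λ₁` and `ηL^k = 1`: the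
U(1) dictionary [BalabanImbrieJaffe1985] (4.5.2)–(4.5.3) for the cut-off field (off `Λ₁` the field is `1 = e^{i·0}` and `Λ₁·A′` is `0`;
`Q^{s*}_k` on real bond functions = `(torusBlockBondsIter P i k).Qsstar`, factor `L^k`; standing range). [cite: BalabanImbrieJaffe1985, (4.5.2) p.312] -/
theorem toC_qsstarGIter_cutoffG_phase {k : ℕ} (hk : i + k ≤ P.m + P.K) {ek η : ℝ} (hη : η * (P.L : ℝ) ^ k = 1)
    (Λ₁ : Finset (PBond P (i + k))) {u' : GaugeField P (i + k) U1} {A' : PBond P (i + k) → ℝ}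
    (hu : ∀ c ∈ Λ₁, u' c = expU1 (ek * A' c)) (b : PBond P i) :
    toC (qsstarGIter k (cutoffG Λ₁ u') b) =
      Complex.exp (I * ((ek * η * (torusBlockBondsIter P i k).Qsstar ((↑Λ₁ : Set (PBond P (i + k))).indicator A') b : ℝ) : ℂ)) := by
  by_cases hb : blockOfIter k b.tgt = blockOfIter k b.src
  · rw [qsstarGIter_of_interior hk _ hb.symm, toC_one,
      (torusBlockBondsIter P i k).Qsstar_of_not_mem _ (not_mem_BsIter_of_interior hb)]
    simp
  · have hmem := mem_BsIter_of_not_interior hk hb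
    rw [qsstarGIter_of_mem hk _ hmem, (torusBlockBondsIter P i k).Qsstar_of_mem _ hmem, iter_L]
    by_cases hc : (⟨blockOfIter k b.src, b.dir⟩ : PBond P (i + k)) ∈ Λ₁
    · rw [cutoffG_of_mem _ hc, hu _ hc, toC_expU1, Set.indicator_of_mem (Finset.mem_coe.2 hc)]
      congr 1
      have hL : ek * η * (((P.L ^ k : ℕ) : ℝ) * A' ⟨blockOfIter k b.src, b.dir⟩) = ek * A' ⟨blockOfIter k b.src, b.dir⟩ := by
        rw [Nat.cast_pow, ← mul_assoc, mul_assoc ek, hη, mul_one]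
      rw [hL]
      push_cast
      ring
    · rw [cutoffG_of_not_mem _ hc, toC_one, Set.indicator_of_notMem (fun h => hc (Finset.mem_coe.1 h))]
      simp

/-- kernel: on the bonds of `Λ̄₁* = (blockUnion k X)*` the cut-off on `A′` is invisible: `Q^{s*}_k(X*·A′) = Q^{s*}_kA′` there (and both vanish
inside k-blocks; standing range). [cite: BalabanImbrieJaffe1988, (5.3.4) p.280] -/
theorem Qsstar_indicator_of_mem_starB {k : ℕ} (hk : i + k ≤ P.m + P.K) (X : Finset (Balaban1983to89.Site P (i + k)))
    (A' : PBond P (i + k) → ℝ) {b : PBond P i} (hb : b ∈ starB (blockUnion k X)) :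
    (torusBlockBondsIter P i k).Qsstar ((↑(starB X) : Set (PBond P (i + k))).indicator A') b =
      (torusBlockBondsIter P i k).Qsstar A' b := by
  by_cases hi : blockOfIter k b.tgt = blockOfIter k b.src
  · rw [(torusBlockBondsIter P i k).Qsstar_of_not_mem _ (not_mem_BsIter_of_interior hi),
      (torusBlockBondsIter P i k).Qsstar_of_not_mem _ (not_mem_BsIter_of_interior hi)]
  · have hmem := mem_BsIter_of_not_interior hk hi
    have hc : (⟨blockOfIter k b.src, b.dir⟩ : PBond P (i + k)) ∈ starB X :=
      mem_liftBonds.1 ((liftBonds_starB_iff hk X hi).2 hb)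
    rw [(torusBlockBondsIter P i k).Qsstar_of_mem _ hmem, (torusBlockBondsIter P i k).Qsstar_of_mem _ hmem,
      Set.indicator_of_mem (Finset.mem_coe.2 hc)]

/-! ## §4 (5.3.3): the background field (4.2) after the translation (5.3.1), on the torus -/

/-- **(5.3.1) in this file's vocabulary IS r16's `transl531` with the printed unit-lattice cut-off `Λ₁^{(k)*} = (blockUnion 1 X)*`** (`X` the block
sites of `Λ₁`): a surface bond lies in `(blockUnion 1 X)*` iff its block bond lies in `X*` (gen 5's `toC_transl_eq_transl531`; standing range).
[cite: BalabanImbrieJaffe1988, (5.3.1) p.280] -/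
theorem transl_eq_transl531 {n : ℕ} (hn : n + 1 ≤ P.m + P.K) (X : Finset (Balaban1983to89.Site P (n + 1))) (u' : GaugeField P n U1)
    (v : GaugeField P (n + 1) U1) (b : PBond P n) :
    toC (surfMul u' (cutoff (starB X) v) b) =
      transl531 (starB (blockUnion 1 X)) (fun b => toC (u' b)) (fun b => toC (surfFactor v b)) b := by
  refine BIJ88Eq536Linearization.toC_transl_eq_transl531 (fun b hb => ?_) u' v b
  rw [mem_starB, mem_starB, mem_blockUnion_one, mem_blockUnion_one, blockOf_tgt_of_isCross hn hb]
  exact Iff.rfl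

/-- **(5.3.3), operator form**: for `u = u′·(Λ₁^{(k)′*}Q^{s*}v)` ((5.3.1), block-lattice cut-off `X* = Λ₁^{(k)′*}`) with `u′ = e^{ie_kA′}` on
`Λ₁^{(k)*} = (blockUnion 1 X)*`, and `ηL^k = 1`, the background field (4.2) `u_k = (Q^{s*}_ku) exp(−ie_kηg)` (`g = 𝒟_{k,loc}∂*Q^{e*}_kf^{(k)}`, data
as in the typed (4.2); `f^{(k)}` after the translation = (5.3.2), `BIJ88Eq532Torus`) equals, at EVERY η-lattice bond,
`Q^{s*}_k(Λ₁^{*c}u′) · Q^{s*}_{k+1}(Λ₁′^{*}v) · exp ie_kη[Q^{s*}_k(Λ₁*A′) − g]` (standing range). [cite: BalabanImbrieJaffe1988, (5.3.3) p.280] -/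
theorem eq533_operator {k : ℕ} (hk : i + k + 1 ≤ P.m + P.K) {ek η : ℝ} (hη : η * (P.L : ℝ) ^ k = 1)
    (X : Finset (Balaban1983to89.Site P (i + k + 1))) {u' : GaugeField P (i + k) U1} {A' : PBond P (i + k) → ℝ}
    (hu : ∀ c ∈ starB (blockUnion 1 X), u' c = expU1 (ek * A' c)) (v : GaugeField P (i + k + 1) U1) (g : PBond P i → ℝ)
    (b : PBond P i) :
    backgroundU ek η (fun b => toC (qsstarGIter k (surfMul u' (cutoff (starB X) v)) b)) g b =
      toC (qsstarGIter k (cutoffG (starB (blockUnion 1 X))ᶜ u') b) * toC (qsstarGIter (k + 1) (cutoffG (starB X) v) b) *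
        Complex.exp (I * ((ek * η *
          ((torusBlockBondsIter P i k).Qsstar ((↑(starB (blockUnion 1 X)) : Set (PBond P (i + k))).indicator A') b - g b) : ℝ) : ℂ)) := by
  have hsplit : qsstarGIter k u' b =
      qsstarGIter k (cutoffG (starB (blockUnion 1 X))ᶜ u') b * qsstarGIter k (cutoffG (starB (blockUnion 1 X)) u') b :=
    qsstarGIter_mul k _ _ u' (fun c => (cutoffG_compl_mul_cutoffG _ u' c).symm) b
  simp only [backgroundU]
  rw [qsstarGIter_surfMul hk, cutoff_eq_cutoffG, hsplit, toC_mul, toC_mul,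
    toC_qsstarGIter_cutoffG_phase (i := i) (k := k) (by omega) hη _ hu b]
  rw [mul_right_comm _ (Complex.exp _) _, mul_assoc _ (Complex.exp _) _, ← Complex.exp_add]
  congr 2
  push_cast
  ring

/-- **(5.3.3) ON THE TORUS, in the printed `Λ̄` notation**: under the hypotheses of `eq533_operator`, at every η-lattice bond `b`,
`u_k(b) = (Λ̄₁^{(k)*c}Q^{s*}_ku′)(b) · (Λ̄₁^{(k)*}Q^{s*}_{k+1}v)(b) · exp ie_kη[(Q^{s*}_kΛ₁^{(k)*}A′)(b) − g(b)]`, `Λ̄₁^{(k)} = blockUnion (k+1) X`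
(the η-lattice blocks under `Λ₁^{(k)}`), i.e. OUTSIDE `Λ̄₁*` the prefactor is the untranslated `Q^{s*}_ku`, INSIDE it is the new block field
pulled back `k+1` times.  (Print: prefactor `(Λ̄₁^{(k)*c}Q^{s*}_{k+1}v)` — see §5 and HOME/GAPS.md.) [cite: BalabanImbrieJaffe1988, (5.3.3) p.280] -/
theorem eq533_torus {k : ℕ} (hk : i + k + 1 ≤ P.m + P.K) {ek η : ℝ} (hη : η * (P.L : ℝ) ^ k = 1)
    (X : Finset (Balaban1983to89.Site P (i + k + 1))) {u' : GaugeField P (i + k) U1} {A' : PBond P (i + k) → ℝ}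
    (hu : ∀ c ∈ starB (blockUnion 1 X), u' c = expU1 (ek * A' c)) (v : GaugeField P (i + k + 1) U1) (g : PBond P i → ℝ)
    (b : PBond P i) :
    backgroundU ek η (fun b => toC (qsstarGIter k (surfMul u' (cutoff (starB X) v)) b)) g b =
      toC (cutoffG (starB (blockUnion (k + 1) X))ᶜ (qsstarGIter k u') b) *
        toC (cutoffG (starB (blockUnion (k + 1) X)) (qsstarGIter (k + 1) v) b) *
        Complex.exp (I * ((ek * η *
          ((torusBlockBondsIter P i k).Qsstar ((↑(starB (blockUnion 1 X)) : Set (PBond P (i + k))).indicator A') b - g b) : ℝ) : ℂ)) := by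
  rw [eq533_operator hk hη X hu v g b, qsstarGIter_cutoffG_starB_compl (i := i) (k := k) (by omega) (blockUnion 1 X) u' b,
    qsstarGIter_cutoffG_starB (i := i) (k := k + 1) hk X v b, blockUnion_succ (i := i) k X]

/-- **(5.3.3) INSIDE `Λ̄₁^{(k)*}`** (so in particular in `Λ̄₂^{(k)*} ⊂ Λ̄₁^{(k)*}`): for `b ∈ (blockUnion (k+1) X)*`,
`u_k(b) = (Q^{s*}_{k+1}v)(b) · exp ie_kη[(Q^{s*}_kA′)(b) − g(b)]` — the prefactor and the first exponent of (5.3.4) (standing range).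
[cite: BalabanImbrieJaffe1988, (5.3.4) p.280] -/
theorem eq533_inside {k : ℕ} (hk : i + k + 1 ≤ P.m + P.K) {ek η : ℝ} (hη : η * (P.L : ℝ) ^ k = 1)
    (X : Finset (Balaban1983to89.Site P (i + k + 1))) {u' : GaugeField P (i + k) U1} {A' : PBond P (i + k) → ℝ}
    (hu : ∀ c ∈ starB (blockUnion 1 X), u' c = expU1 (ek * A' c)) (v : GaugeField P (i + k + 1) U1) (g : PBond P i → ℝ)
    {b : PBond P i} (hb : b ∈ starB (blockUnion (k + 1) X)) :
    backgroundU ek η (fun b => toC (qsstarGIter k (surfMul u' (cutoff (starB X) v)) b)) g b =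
      toC (qsstarGIter (k + 1) v b) *
        Complex.exp (I * ((ek * η * ((torusBlockBondsIter P i k).Qsstar A' b - g b) : ℝ) : ℂ)) := by
  have hb' : b ∈ starB (blockUnion k (blockUnion 1 X)) := by rwa [← blockUnion_succ]
  rw [eq533_torus hk hη X hu v g b, cutoffG_of_not_mem _ (fun h => (Finset.mem_compl.1 h) hb), toC_one, one_mul,
    cutoffG_of_mem _ hb, Qsstar_indicator_of_mem_starB (i := i) (k := k) (by omega) _ A' hb']

/-- **"In Λ̄₂^{(k)*} this simplifies to (5.3.4)"** — the bridge to r16's typed (5.3.4) `BIJ88Sect5StatementsPart3.bg534`: on a bond `b ∈ Λ̄₁^{(k)*}`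
at which the (localized, p. 260) operator `T = 𝒟_{k,loc}∂*Q^{e*}_k` sees the translated field `f^{(k)}` of (5.3.2) only through its small-field
form, `g(b) = (T(∂A′ + L^{−2}Q^{e*}f))(b)` (the displayed content of the restriction to `Λ̄₂*`; hypothesis `hT`), and for any linear `Qss` agreeing
with the torus `Q^{s*}_k` at `(A′, b)` (hypothesis `hQ`), the background field IS `bg534 e_k η L (Q^{s*}_{k+1}v) Qss T ∂ Q^{e*} A′ f` at `b`
(standing range). [cite: BalabanImbrieJaffe1988, (5.3.4) p.280] -/
theorem eq534_of_eq533 {k : ℕ} (hk : i + k + 1 ≤ P.m + P.K) {ek η : ℝ} (hη : η * (P.L : ℝ) ^ k = 1)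
    (X : Finset (Balaban1983to89.Site P (i + k + 1))) {u' : GaugeField P (i + k) U1} {A' : PBond P (i + k) → ℝ}
    (hu : ∀ c ∈ starB (blockUnion 1 X), u' c = expU1 (ek * A' c)) (v : GaugeField P (i + k + 1) U1) (g : PBond P i → ℝ)
    {b : PBond P i} (hb : b ∈ starB (blockUnion (k + 1) X))
    {Plc : Type*} (L : ℝ) (Qss : (PBond P (i + k) → ℝ) →ₗ[ℝ] (PBond P i → ℝ))
    (T : (Balaban1983to89.Plaq P (i + k) → ℝ) →ₗ[ℝ] (PBond P i → ℝ))
    (dd : (PBond P (i + k) → ℝ) →ₗ[ℝ] (Balaban1983to89.Plaq P (i + k) → ℝ)) (Qes : (Plc → ℝ) →ₗ[ℝ] (Balaban1983to89.Plaq P (i + k) → ℝ))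
    (f : Plc → ℝ) (hQ : Qss A' b = (torusBlockBondsIter P i k).Qsstar A' b) (hT : g b = T (dd A' + L⁻¹ ^ 2 • Qes f) b) :
    backgroundU ek η (fun b => toC (qsstarGIter k (surfMul u' (cutoff (starB X) v)) b)) g b =
      bg534 ek η L (fun b => toC (qsstarGIter (k + 1) v b)) Qss T dd Qes A' f b := by
  rw [eq533_inside hk hη X hu v g hb]
  simp only [bg534, bgExp, bracket534, Pi.sub_apply]
  rw [hQ, hT]

/-! ## §5 The printed prefactor of (5.3.3), read literally -/

/-- kernel: READ LITERALLY, the printed prefactor `(Λ̄₁^{(k)*c}Q^{s*}_{k+1}v)` — the cut-off of `Q^{s*}_{k+1}v` to the COMPLEMENT of `Λ̄₁*` — is `1`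
on every bond of `Λ̄₁^{(k)*} ⊇ Λ̄₂^{(k)*}`, where (5.3.4) prints the prefactor `Q^{s*}_{k+1}v`. [cite: BalabanImbrieJaffe1988, (5.3.3) p.280] -/
theorem prefactor533_literal_inside {k : ℕ} (X : Finset (Balaban1983to89.Site P (i + k + 1))) (v : GaugeField P (i + k + 1) U1)
    {b : PBond P i} (hb : b ∈ starB (blockUnion (k + 1) X)) :
    cutoffG (starB (blockUnion (k + 1) X))ᶜ (qsstarGIter (k + 1) v) b = 1 :=
  cutoffG_of_not_mem _ (fun h => (Finset.mem_compl.1 h) hb)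

/-- kernel: with NO small-field region (`Λ₁^{(k)} = ∅`: no translation at all, `u = u′`) the literal right side of (5.3.3),
`(Λ̄₁^{*c}Q^{s*}_{k+1}v) exp ie_kη[Q^{s*}_kΛ₁*A′ − g] = (Q^{s*}_{k+1}v) e^{−ie_kηg}`, is NOT the background field (4.2) `(Q^{s*}_ku′)e^{−ie_kηg}`:
take `v = 1` and `u′ ≡ e^{iπ}`; at any bond of a k-corridor (there are `(L^k)^{d−1} ≥ 1` of them, `BIJ85Eq224Proof.card_BsIter`) the two sides are
`−e^{−ie_kηg}` and `e^{−ie_kηg}` (standing range).  Hence the reading recorded in §4 / HOME/GAPS.md. [cite: BalabanImbrieJaffe1988, (5.3.3) p.280] -/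
theorem eq533_literal_ne {k : ℕ} (hk : i + k + 1 ≤ P.m + P.K) (ek η : ℝ) (A' : PBond P (i + k) → ℝ) (g : PBond P i → ℝ) :
    ∃ (u' : GaugeField P (i + k) U1) (v : GaugeField P (i + k + 1) U1) (b : PBond P i),
      (∀ c ∈ starB (blockUnion 1 (∅ : Finset (Balaban1983to89.Site P (i + k + 1)))), u' c = expU1 (ek * A' c)) ∧
      backgroundU ek η (fun b => toC (qsstarGIter k (surfMul u' (cutoff (starB ∅) v)) b)) g b ≠
        toC (cutoffG (starB (blockUnion (k + 1) (∅ : Finset (Balaban1983to89.Site P (i + k + 1)))))ᶜ (qsstarGIter (k + 1) v) b) *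
          Complex.exp (I * ((ek * η *
            ((torusBlockBondsIter P i k).Qsstar
              ((↑(starB (blockUnion 1 (∅ : Finset (Balaban1983to89.Site P (i + k + 1))))) : Set (PBond P (i + k))).indicator A') b -
              g b) : ℝ) : ℂ)) := by
  classical
  -- a bond `b` in some k-corridor (every corridor has `(L^k)^{d−1} ≥ 1` bonds)
  have hpos : 0 < ((torusBlockBondsIter P i k).Bs (⟨default, ⟨0, P.hd⟩⟩ : PBond P (i + k))).card := by
    rw [card_BsIter k (by omega)]
    exact pow_pos (pow_pos P.L_pos k) _
  obtain ⟨b, hb⟩ := Finset.card_pos.1 hpos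
  -- with no small-field region every cut-off set is empty
  have hX1 : starB (blockUnion 1 (∅ : Finset (Balaban1983to89.Site P (i + k + 1)))) = (∅ : Finset (PBond P (i + k))) := by
    ext c
    simp [mem_starB, mem_blockUnion]
  have hXk : starB (blockUnion (k + 1) (∅ : Finset (Balaban1983to89.Site P (i + k + 1)))) = (∅ : Finset (PBond P i)) := by
    ext c
    simp [mem_starB, mem_blockUnion]
  have hX : starB (∅ : Finset (Balaban1983to89.Site P (i + k + 1))) = (∅ : Finset (PBond P (i + k + 1))) := by
    ext c
    simp [mem_starB]
  refine ⟨fun _ => expU1 π, fun _ => 1, b, fun c hc => ?_, ?_⟩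
  · rw [hX1] at hc
    exact absurd hc (Finset.notMem_empty c)
  · -- `Q^{s*}_{k+1}1 = 1`
    have hone : qsstarGIter (k + 1) (fun _ : PBond P (i + k + 1) => (1 : U1)) b = 1 := by
      rw [qsstarGIter_eq (k + 1) hk]
      split_ifs <;> rfl
    -- the (4.2) prefactor: `Q^{s*}_ku = Q^{s*}_ku′ = e^{iπ}` on the corridor bond `b`
    have hu1 : qsstarGIter k (surfMul (fun _ => expU1 π)
        (cutoff (starB (∅ : Finset (Balaban1983to89.Site P (i + k + 1)))) fun _ => (1 : U1))) b = expU1 π := by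
      rw [qsstarGIter_transl hk, hX]
      have h1 : cutoffG (liftBonds (k + 1) (∅ : Finset (PBond P (i + k + 1))))
          (qsstarGIter (k + 1) fun _ : PBond P (i + k + 1) => (1 : U1)) b = 1 := by
        simp only [cutoffG, hone, ite_self]
      rw [h1, mul_one]
      exact qsstarGIter_of_mem (by omega) _ hb
    -- the exponent's first term vanishes (`Λ₁* = ∅`)
    have hQ0 : (torusBlockBondsIter P i k).Qsstar
        ((↑(starB (blockUnion 1 (∅ : Finset (Balaban1983to89.Site P (i + k + 1))))) : Set (PBond P (i + k))).indicator A') b = 0 := by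
      rw [hX1]
      simp [BIJ85Sect2SurfaceAverages.BlockBonds.Qsstar]
    intro h
    simp only [backgroundU] at h
    rw [hu1, toC_expU1, hXk, Finset.compl_empty, cutoffG_of_mem _ (Finset.mem_univ b), hone, toC_one, one_mul, hQ0,
      zero_sub] at h
    have hexp : Complex.exp (-(I * ((ek * η * g b : ℝ) : ℂ))) = Complex.exp (I * ((ek * η * -g b : ℝ) : ℂ)) := by
      congr 1
      push_cast
      ring
    rw [hexp, Complex.exp_pi_mul_I] at h
    have hne : Complex.exp (I * ((ek * η * -g b : ℝ) : ℂ)) ≠ 0 := Complex.exp_ne_zero _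
    have h1 : (-1 : ℂ) = 1 := mul_right_cancel₀ hne (by rw [h, one_mul])
    norm_num at h1

end

end Literature.MathematicalPhysics.QuantumFieldTheory.BalabanImbrieJaffe1984to88.BIJ88Eq533Torus
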